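import Literature.NumberTheory.LFunctions.XiTiltedUnconditioning
import HarnessLib

/-!
# The ladder tail lemma for `ξ`: the face inequality with general bulk margin `τ` and `θ = 999/1000`

`Literature/NumberTheory/LFunctions/`. The algebraic heart of the `l ≥ 3` faces of the Jensen track's
THEOREM A (eng-3, LADDER-BL.md §5.5–5.6; design HOME/jensen/p1/THEOREM-A-ASSEMBLY.md v0.2 (C)): given,
for the tilted law `ν_{2n} ∝ u^{2n}Φ(u)du` with mean `ū`, a point `a` with `|ū − a| ≤ 1/460`, a bulk
`[a − τ, ∞)` (`1/460 ≤ τ ≤ 1/40`, `Rτ ≥ 6400`) with mean `c`, a number `R ≥ 219081` and a box parameter `0 < m ≤ 3/20` with `(2n+1) ≤ m·ū²R` (the `μ₂`-type bound),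
a BULK bound `∫_{[b,∞)} u^{2n}Φ|u − c|^l ≤ γ·M_J/(√R)^l` and LEFT-PIECE bounds
`∫₀^b u^{2n}Φ(D + (b−u))^j ≤ ε(D + j/(Rτ))^j M/R` (`D = τ + 1/460`, `ε ≤ 1/960`, `εR⁷ ≤ 10`), then

  `|μ_l(n)| ≤ (√m)^l · γ · (1000/999)^{l−1} + 1/50000`     (`3 ≤ l ≤ 16`; `xi_face_bound_general`),

with the un-conditioning parameter `θ = 999/1000` (so that the Gaussian constant table of `d = 8` fits).

Same proof as `XiLadderFaceSixteen.xi_face_bound_sixteen` (`τ = 1/40`, `θ = 9/10`).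

Mechanism: `abs_xiMu_le_xiAbsMoment` and `xiAbsMoment_mean_le_uncondition` (θ = 999/1000) of
`XiTiltedUnconditioning.lean`, then `√(2n+1)/ū ≤ √(3/20)·√R` on the three terms. Pure bookkeeping: no
property of `Φ` beyond positivity is used here; the analytic inputs (mode, floors, Gaussian domination,
convexity tails) are supplied by the caller (the row files `d = 5…8`). Theorems only.

References: Griffin–Ono–Rolen–Zagier, PNAS 116 (2019), Thm 7 / §5.1 [GORZPNAS2019].
-/

noncomputable section

open MeasureTheory Set Filter
open scoped Topology

namespace Literature.NumberTheory.LFunctions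

/-- Splitting the mass of `u^kΦ(u)du` at `b > 0`. [folklore] -/
private theorem xiMoment_eq_Ioo_add_Ici (k : ℕ) {b : ℝ} (hb : 0 < b) :
    xiMoment k = (∫ u in Ioo 0 b, deBruijnPhi u * u ^ k) + ∫ u in Ici b, deBruijnPhi u * u ^ k := by
  have hf := integrableOn_deBruijnPhi_mul_pow k
  have hsub : Ici b ⊆ Ioi (0 : ℝ) := fun u hu => lt_of_lt_of_le hb hu
  have hdisj : Disjoint (Ioo (0 : ℝ) b) (Ici b) :=
    disjoint_left.2 fun u hu hu' => not_le.2 hu.2 (mem_Ici.1 hu')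
  rw [xiMoment, ← Ioo_union_Ici_eq_Ioi hb, setIntegral_union hdisj measurableSet_Ici
    (hf.mono_set Ioo_subset_Ioi_self) (hf.mono_set hsub)]

/-- **The generic face inequality** (see the module docstring for the meaning of the hypotheses).
[cite: GORZPNAS2019, Thm 7 and §5.1] -/
theorem xi_face_bound_general (n l : ℕ) (hl3 : 3 ≤ l) (hl8 : l ≤ 16) {a R γ c ε m τ : ℝ}
    (hm0 : 0 < m) (hm : m ≤ 3 / 20) (hτlo : 1 / 460 ≤ τ) (hτhi : τ ≤ 1 / 40) (hRτ : 6400 ≤ R * τ)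
    (ha : 17 / 8 ≤ a) (hR : 219081 ≤ R) (hγ : 0 ≤ γ) (hε0 : 0 ≤ ε) (hε : ε ≤ 1 / 960)
    (hεR : ε * R ^ 7 ≤ 10)
    (hmean_lo : a - 1 / 460 ≤ xiMean (2 * n)) (hmean_hi : xiMean (2 * n) ≤ a + 1 / 460)
    (hmhat : (2 * (n : ℝ) + 1) ≤ m * xiMean (2 * n) ^ 2 * R)
    (hc : (∫ u in Ici (a - τ), deBruijnPhi u * u ^ (2 * n)) * c =
      ∫ u in Ici (a - τ), deBruijnPhi u * u ^ (2 * n) * u)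
    (hbulk : ∫ u in Ici (a - τ), deBruijnPhi u * u ^ (2 * n) * |u - c| ^ l ≤
      γ * (∫ u in Ici (a - τ), deBruijnPhi u * u ^ (2 * n)) / Real.sqrt R ^ l)
    (hI : ∀ j : ℕ, j ≤ 16 →
      ∫ u in Ioo 0 (a - τ), deBruijnPhi u * u ^ (2 * n) * ((τ + 1 / 460) + ((a - τ) - u)) ^ j ≤
        ε * ((τ + 1 / 460) + j / (R * τ)) ^ j / R * xiMoment (2 * n)) :
    |xiMu n l| ≤ Real.sqrt m ^ l * (γ * (1000 / 999) ^ (l - 1)) + 1 / 50000 := by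
  -- names
  set k : ℕ := 2 * n with hk
  set b : ℝ := a - τ with hb
  set D : ℝ := τ + 1 / 460 with hD
  set ū : ℝ := xiMean k with hū
  set M : ℝ := xiMoment k with hM
  set MJ : ℝ := ∫ u in Ici b, deBruijnPhi u * u ^ k with hMJ
  set I₁ : ℝ := ∫ u in Ioo 0 b, deBruijnPhi u * u ^ k * (D + (b - u)) with hI₁
  set Il : ℝ := ∫ u in Ioo 0 b, deBruijnPhi u * u ^ k * (D + (b - u)) ^ l with hIl
  set sR : ℝ := Real.sqrt R with hsR
  set q : ℝ := Real.sqrt m with hq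
  have hb0 : 0 < b := by rw [hb]; linarith
  have hτ0 : 0 < τ := by linarith
  have hR0 : 0 < R := by linarith
  have hsR0 : 0 < sR := Real.sqrt_pos.2 hR0
  have hsR1 : 1 ≤ sR := by
    rw [hsR, show (1 : ℝ) = Real.sqrt 1 by simp]; exact Real.sqrt_le_sqrt (by linarith)
  have hsR468 : 468 ≤ sR := by
    rw [hsR, show (468 : ℝ) = Real.sqrt (468 ^ 2) by rw [Real.sqrt_sq (by norm_num)]]
    exact Real.sqrt_le_sqrt (by nlinarith)
  have hsRsq : sR ^ 2 = R := Real.sq_sqrt hR0.le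
  have hq0 : 0 < q := Real.sqrt_pos.2 hm0
  have hqsq : q ^ 2 = m := Real.sq_sqrt hm0.le
  have hqle : q ≤ 3873 / 10000 := by
    rw [hq, show (3873 / 10000 : ℝ) = Real.sqrt ((3873 / 10000) ^ 2) by rw [Real.sqrt_sq (by norm_num)]]
    exact Real.sqrt_le_sqrt (by linarith)
  have hM0 : 0 < M := xiMoment_pos k
  have hū0 : 0 < ū := xiMean_pos k
  have hl1 : 1 ≤ l := by omega
  -- masses: `M = I₀ + MJ`, `I₀ ≤ ε M / R`, hence `M/2 ≤ MJ ≤ M`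
  have hsplit : M = (∫ u in Ioo 0 b, deBruijnPhi u * u ^ k) + MJ := xiMoment_eq_Ioo_add_Ici k hb0
  have hI0 := hI 0 (by norm_num)
  simp only [pow_zero, mul_one] at hI0
  have hI0' : ∫ u in Ioo 0 b, deBruijnPhi u * u ^ k ≤ ε / R * M := by
    have e : ε * 1 / R * M = ε / R * M := by ring
    linarith [hI0, e.le, e.symm.le]
  have hIoo0 : 0 ≤ ∫ u in Ioo 0 b, deBruijnPhi u * u ^ k :=
    setIntegral_nonneg measurableSet_Ioo fun u hu =>
      (mul_pos (deBruijnPhi_pos_holds u) (pow_pos hu.1 k)).le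
  have hMJle : MJ ≤ M := by linarith only [hsplit, hIoo0]
  have hεR' : ε / R ≤ 1 / 2 := by
    rw [div_le_iff₀ hR0]; linarith only [hε, hR]
  have hMJge : M / 2 ≤ MJ := by
    have h : ∫ u in Ioo 0 b, deBruijnPhi u * u ^ k ≤ M / 2 := by
      calc ∫ u in Ioo 0 b, deBruijnPhi u * u ^ k ≤ ε / R * M := hI0'
        _ ≤ 1 / 2 * M := mul_le_mul_of_nonneg_right hεR' hM0.le
        _ = M / 2 := by ring
    linarith only [hsplit, h]
  have hMJ0 : 0 < MJ := by linarith
  -- the un-conditioning inequality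
  have hbū : b ≤ ū := by rw [hb, hū, hk]; linarith
  have hDū : ū - b ≤ D := by rw [hb, hD, hū, hk]; linarith
  have hunc := xiAbsMoment_mean_le_uncondition k hl1 (b := b) (θ := 999 / 1000) (D := D)
    (G := γ * MJ / sR ^ l) (c := c) hb0 (by norm_num) (by norm_num) hc hbū hDū hbulk
  -- abbreviations of the three pieces
  have hθ : (1 : ℝ) - 999 / 1000 = 1 / 1000 := by norm_num
  rw [hθ] at hunc
  -- normalisation: `Q = √(2n+1)/ū ≤ q·√R`
  have hkcast : ((2 * n : ℕ) : ℝ) = 2 * (n : ℝ) := by push_cast; ring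
  have hQ := abs_xiMu_le_xiAbsMoment n l
  set A : ℝ := xiAbsMoment (2 * n) l (xiMean (2 * n)) with hA
  have hA0 : 0 ≤ A := by
    rw [hA, xiAbsMoment]
    exact setIntegral_nonneg measurableSet_Ioi fun u hu =>
      mul_nonneg (mul_pos (deBruijnPhi_pos_holds u) (pow_pos hu _)).le (pow_nonneg (abs_nonneg _) _)
  have hQ1 : Real.sqrt (2 * n + 1) ≤ q * sR * ū := by
    have h1 : (2 * (n : ℝ) + 1) ≤ (q * sR * ū) ^ 2 := by
      have e : (q * sR * ū) ^ 2 = m * ū ^ 2 * R := by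
        rw [mul_pow, mul_pow, hqsq, hsRsq]; ring
      rw [e]; exact hmhat
    have h2 : 0 ≤ q * sR * ū := by positivity
    calc Real.sqrt (2 * n + 1) ≤ Real.sqrt ((q * sR * ū) ^ 2) := Real.sqrt_le_sqrt h1
      _ = q * sR * ū := Real.sqrt_sq h2
  have hQl : Real.sqrt (2 * n + 1) ^ l ≤ (q * sR) ^ l * ū ^ l := by
    rw [← mul_pow]; exact pow_le_pow_left₀ (Real.sqrt_nonneg _) hQ1 l
  -- |μ_l| ≤ (q sR)^l · A / M
  have hstep1 : |xiMu n l| ≤ (q * sR) ^ l * A / M := by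
    refine hQ.trans ?_
    rw [div_le_div_iff₀ (by positivity) hM0]
    calc Real.sqrt (2 * ↑n + 1) ^ l * A * M = Real.sqrt (2 * ↑n + 1) ^ l * (A * M) := by ring
      _ ≤ (q * sR) ^ l * ū ^ l * (A * M) :=
          mul_le_mul_of_nonneg_right hQl (mul_nonneg hA0 hM0.le)
      _ = (q * sR) ^ l * A * (ū ^ l * M) := by ring
  -- bound the three pieces of `A`
  have hT1 : (q * sR) ^ l * (γ * MJ / sR ^ l / (999 / 1000) ^ (l - 1)) / M ≤
      q ^ l * (γ * (1000 / 999) ^ (l - 1)) := by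
    have e : (q * sR) ^ l * (γ * MJ / sR ^ l / (999 / 1000) ^ (l - 1)) / M =
        q ^ l * (γ * (1000 / 999) ^ (l - 1)) * (MJ / M) := by
      rw [mul_pow]
      have hsRl : sR ^ l ≠ 0 := pow_ne_zero _ hsR0.ne'
      have h9 : ((999 : ℝ) / 1000) ^ (l - 1) ≠ 0 := pow_ne_zero _ (by norm_num)
      field_simp
      rw [show ((1000 : ℝ) / 999) ^ (l - 1) = 1000 ^ (l - 1) / 999 ^ (l - 1) by rw [div_pow],
        show ((999 : ℝ) / 1000) ^ (l - 1) = 999 ^ (l - 1) / 1000 ^ (l - 1) by rw [div_pow]]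
      field_simp
    rw [e]
    have hr : MJ / M ≤ 1 := by rw [div_le_one hM0]; exact hMJle
    have h0 : 0 ≤ q ^ l * (γ * (1000 / 999) ^ (l - 1)) := by positivity
    calc q ^ l * (γ * (1000 / 999) ^ (l - 1)) * (MJ / M) ≤ q ^ l * (γ * (1000 / 999) ^ (l - 1)) * 1 :=
          mul_le_mul_of_nonneg_left hr h0
      _ = _ := mul_one _
  -- the left piece
  have hIl' : Il ≤ ε * (D + l / (R * τ)) ^ l / R * M := hI l hl8
  have hRτ0 : 0 < R * τ := by positivity
  have hDl : D + l / (R * τ) ≤ 2968 / 100000 := by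
    have hl8' : (l : ℝ) ≤ 16 := by exact_mod_cast hl8
    have h : (l : ℝ) / (R * τ) ≤ 16 / 6400 := by
      calc (l : ℝ) / (R * τ) ≤ 16 / (R * τ) := div_le_div_of_nonneg_right hl8' hRτ0.le
        _ ≤ 16 / 6400 := div_le_div_of_nonneg_left (by norm_num) (by norm_num) hRτ
    rw [hD]; linarith only [h, hτhi]
  have hD0 : 0 ≤ D + l / (R * τ) := by rw [hD]; positivity
  have hT3 : (q * sR) ^ l * Il / M ≤ 33 / 2000000 := by
    have h1 : (q * sR) ^ l * Il / M ≤ (q * sR) ^ l * (ε * (D + l / (R * τ)) ^ l / R) := by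
      rw [div_le_iff₀ hM0]
      have h := mul_le_mul_of_nonneg_left hIl' (pow_nonneg (by positivity : 0 ≤ q * sR) l)
      calc (q * sR) ^ l * Il ≤ (q * sR) ^ l * (ε * (D + l / (R * τ)) ^ l / R * M) := h
        _ = (q * sR) ^ l * (ε * (D + l / (R * τ)) ^ l / R) * M := by ring
    refine h1.trans ?_
    -- `(q sR)^l (D+40l/R)^l ε / R = (q (D+40l/R))^l · ε · sR^l / R ≤ 0.0115^l · ε R⁷`
    have e : (q * sR) ^ l * (ε * (D + l / (R * τ)) ^ l / R) =
        (q * (D + l / (R * τ))) ^ l * (ε * (sR ^ l / R)) := by rw [mul_pow, mul_pow]; ring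
    rw [e]
    have hsmall : q * (D + l / (R * τ)) ≤ 115 / 10000 := by
      calc q * (D + l / (R * τ)) ≤ 3873 / 10000 * (2968 / 100000) :=
            mul_le_mul hqle hDl hD0 (by norm_num)
        _ ≤ 115 / 10000 := by norm_num
    have hsmall0 : 0 ≤ q * (D + l / (R * τ)) := by positivity
    have hpow : (q * (D + l / (R * τ))) ^ l ≤ (115 / 10000 : ℝ) ^ 3 := by
      calc (q * (D + l / (R * τ))) ^ l ≤ (q * (D + l / (R * τ))) ^ 3 :=
            pow_le_pow_of_le_one hsmall0 (by linarith) hl3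
        _ ≤ (115 / 10000) ^ 3 := pow_le_pow_left₀ hsmall0 hsmall 3
    -- `sR^l / R ≤ sR^16 / sR^2 = R^7`
    have hsRl : sR ^ l / R ≤ R ^ 7 := by
      have h2 : sR ^ l ≤ sR ^ 16 := pow_le_pow_right₀ hsR1 hl8
      have h3 : sR ^ 16 = R ^ 7 * R := by
        rw [show (16 : ℕ) = 2 * 8 from rfl, pow_mul, hsRsq]; ring
      rw [div_le_iff₀ hR0]; linarith
    have hεsR : ε * (sR ^ l / R) ≤ 10 := by
      calc ε * (sR ^ l / R) ≤ ε * R ^ 7 := mul_le_mul_of_nonneg_left hsRl hε0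
        _ ≤ 10 := hεR
    calc (q * (D + l / (R * τ))) ^ l * (ε * (sR ^ l / R))
        ≤ (115 / 10000 : ℝ) ^ 3 * 10 := mul_le_mul hpow hεsR (by positivity) (by positivity)
      _ ≤ 33 / 2000000 := by norm_num
  -- the mean-shift piece
  have hI1' : I₁ ≤ ε * (D + 1 / (R * τ)) / R * M := by
    have h := hI 1 (by norm_num)
    simp only [pow_one, Nat.cast_one] at h
    exact h
  have hI1_0 : 0 ≤ I₁ :=
    setIntegral_nonneg measurableSet_Ioo fun u hu =>
      mul_nonneg (mul_pos (deBruijnPhi_pos_holds u) (pow_pos hu.1 k)).le (by rw [hD]; linarith [hu.2])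
  have hT2 : (q * sR) ^ l * (I₁ ^ l / ((1 / 1000) ^ (l - 1) * MJ ^ (l - 1))) / M ≤ 1 / 10 ^ 10 := by
    -- `x := q sR I₁ / MJ ≤ 10⁻⁷`, and the piece is `10^{l-1} x^l (MJ/M) ≤ 10^{l-1} x^l`
    set x : ℝ := q * sR * I₁ / MJ with hx
    have hx0 : 0 ≤ x := by positivity
    have hxle : x ≤ 1 / 10 ^ 7 := by
      rw [hx, div_le_iff₀ hMJ0]
      have h1 : q * sR * I₁ ≤ q * sR * (ε * (D + 1 / (R * τ)) / R * M) :=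
        mul_le_mul_of_nonneg_left hI1' (by positivity)
      -- `q sR ε (D + 40/R)/R · M ≤ 10⁻⁷ · (M/2) ≤ 10⁻⁷ MJ`
      have h2 : q * sR * (ε * (D + 1 / (R * τ)) / R) ≤ 1 / 10 ^ 7 / 2 := by
        have hDR : D + 1 / (R * τ) ≤ 2737 / 100000 := by
          have h40 : 1 / (R * τ) ≤ 1 / 6400 := div_le_div_of_nonneg_left (by norm_num) (by norm_num) hRτ
          rw [hD]; linarith only [h40, hτhi]
        have hsRR : sR / R ≤ 1 / 468 := by
          rw [div_le_div_iff₀ hR0 (by norm_num)]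
          have h' : sR * 468 ≤ sR * sR := mul_le_mul_of_nonneg_left hsR468 hsR0.le
          have e' : sR * sR = R := by rw [← sq]; exact hsRsq
          linarith only [h', e']
        calc q * sR * (ε * (D + 1 / (R * τ)) / R) = q * ε * (D + 1 / (R * τ)) * (sR / R) := by ring
          _ ≤ 3873 / 10000 * (1 / 960) * (2737 / 100000) * (1 / 468) := by
              have h0 : (0 : ℝ) ≤ D + 1 / (R * τ) := by rw [hD]; positivity
              gcongr
          _ ≤ 1 / 10 ^ 7 / 2 := by norm_num
      calc q * sR * I₁ ≤ q * sR * (ε * (D + 1 / (R * τ)) / R * M) := h1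
        _ = q * sR * (ε * (D + 1 / (R * τ)) / R) * M := by ring
        _ ≤ 1 / 10 ^ 7 / 2 * M := mul_le_mul_of_nonneg_right h2 hM0.le
        _ ≤ 1 / 10 ^ 7 * MJ := by linarith only [hMJge]
    obtain ⟨m, rfl⟩ : ∃ m, l = m + 1 := ⟨l - 1, (Nat.sub_add_cancel hl1).symm⟩
    rw [Nat.add_sub_cancel]
    have hMJne : MJ ≠ 0 := hMJ0.ne'
    have hMne : M ≠ 0 := hM0.ne'
    have e : (q * sR) ^ (m + 1) * (I₁ ^ (m + 1) / ((1 / 1000) ^ m * MJ ^ m)) / M =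
        1000 ^ m * x ^ (m + 1) * (MJ / M) := by
      rw [hx]
      simp only [div_pow, mul_pow, one_pow]
      field_simp
      ring
    rw [e]
    have hr : MJ / M ≤ 1 := by rw [div_le_one hM0]; exact hMJle
    have hxm : x ^ (m + 1) ≤ (1 / 10 ^ 7) ^ (m + 1) := pow_le_pow_left₀ hx0 hxle _
    have hm2 : 2 ≤ m := by omega
    have hm7 : m ≤ 15 := by omega
    calc (1000 : ℝ) ^ m * x ^ (m + 1) * (MJ / M) ≤ 1000 ^ m * (1 / 10 ^ 7) ^ (m + 1) * 1 := by
          gcongr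
      _ ≤ 1 / 10 ^ 10 := by
          interval_cases m <;> norm_num
  -- assemble
  have hsum : (q * sR) ^ l * A / M ≤
      (q * sR) ^ l * (γ * MJ / sR ^ l / (999 / 1000) ^ (l - 1)) / M +
      (q * sR) ^ l * (I₁ ^ l / ((1 / 1000) ^ (l - 1) * MJ ^ (l - 1))) / M +
      (q * sR) ^ l * Il / M := by
    have h := mul_le_mul_of_nonneg_left hunc (pow_nonneg (by positivity : 0 ≤ q * sR) l)
    have e : (q * sR) ^ l * (γ * MJ / sR ^ l / (999 / 1000) ^ (l - 1)) / M +
        (q * sR) ^ l * (I₁ ^ l / ((1 / 1000) ^ (l - 1) * MJ ^ (l - 1))) / M +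
        (q * sR) ^ l * Il / M =
        (q * sR) ^ l * (γ * MJ / sR ^ l / (999 / 1000) ^ (l - 1) +
          I₁ ^ l / ((1 / 1000) ^ (l - 1) * MJ ^ (l - 1)) + Il) / M := by
      ring
    rw [e]
    exact div_le_div_of_nonneg_right h hM0.le
  calc |xiMu n l| ≤ (q * sR) ^ l * A / M := hstep1
    _ ≤ _ := hsum
    _ ≤ q ^ l * (γ * (1000 / 999) ^ (l - 1)) + 1 / 10 ^ 10 + 33 / 2000000 := by linarith only [hT1, hT2, hT3]
    _ ≤ q ^ l * (γ * (1000 / 999) ^ (l - 1)) + 1 / 50000 := by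
        have hnum : (1 : ℝ) / 10 ^ 10 + 33 / 2000000 ≤ 1 / 50000 := by norm_num
        linarith only [hnum]

end Literature.NumberTheory.LFunctions
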